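import Summits.QuantumFields.GaugeBoot.OneOverNSeriesExpansion
import HarnessLib

/-!
# Power series in `β` of the `1/N` coefficients, V: level two is Chatterjee's `a_k(s)` (gauge-boot, ADDENDUM 31 part E)

HONEST FRAMING (cell `pub-gaugeboot`, page 1 of every file): the venture produces certified bounds
on lattice expectations at stated coupling, gauge group, dimension and torus size; NOT a mass gap,
NOT a continuum limit, NOT a string tension; NOT Yang–Mills-summit-bearing (barriers
`FixedCouplingUltralocality`, `PerturbativeInvisibility`).  Strong-coupling `SO(N)` lattice gauge theory with free boundary
condition (S. Chatterjee, Comm. Math. Phys. **366** (2019); S. Chatterjee, J. Jafarov, arXiv:1604.04777); nothing about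
four-dimensional continuum Yang–Mills or a mass gap.

## Content

Consistency of ADDENDUM 31 with Chatterjee's Corollary 3.5: at level two (the zeroth `1/N` coefficient) the symmetrized
Chatterjee–Jafarov coefficients ARE Chatterjee's string-counting coefficients `a_i(s) = Σ_{X ∈ 𝒳ᵢ(s)} v(X)` (tree `coeffA`):
`b_{2,i}(s) = a_i(s)` for every genuine `s` (`seriesCoeff_two_eq_coeffA`).  Proof: both power series sum to
`f_0(β, s) = Σ_X w_β(X)` for small `β` (`oneOverN_powerSeries` (i)–(iii) and the tree's `hasSum_coeffA_mul_pow`), so the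
identity theorem for absolutely convergent power series (tree `CoeffRecursionProof.eq_zero_of_tsum_eq_zero`) equates the
coefficients; the family `b` is unique (`seriesCoeff_unique`), so the statement holds for ANY family with the characterising
clauses.

Everything is `[folklore]` given part D and the tree's §4/§10 machinery.
-/

noncomputable section

open Finset Filter Topology
open Literature.MathematicalPhysics.QuantumFieldTheory.Chatterjee2019LargeN
open Literature.MathematicalPhysics.QuantumFieldTheory.Chatterjee2019LargeN.CoeffCatalanBoundProof

namespace Summit.QuantumFields.GaugeBoot

namespace StringDuality

variable {d : ℕ}

/-- ★ **Level two of the symmetrized Chatterjee–Jafarov family is Chatterjee's `a_i(s)`.**  For `d ≥ 2` and ANY family `b`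
with the characterising clauses of `seriesCoeff_exists`, `b_{2,i}(s) = a_i(s) = Σ_{X ∈ 𝒳ᵢ(s)} v(X)` (`coeffA s i`) for every
genuine loop sequence `s` and every `i`.
[cite: ChatterjeeJafarov2016OneOverN, Theorem 7.1 («the case k = 0 was established in [chatterjee15]»); Chatterjee2019LargeN, Corollary 3.5, Proposition 4.1, Corollary 10.4] -/
theorem seriesCoeff_two_eq_coeffA (hd : 2 ≤ d) {b : ℕ → ℕ → LoopSeq d → ℝ}
    (h0 : ∀ (i : ℕ) (u : LoopSeq d), b 0 i u = 0) (h1 : ∀ (i : ℕ) (u : LoopSeq d), b 1 i u = 0)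
    (hnil : ∀ k i, b (k + 2) i [] = if k = 0 ∧ i = 0 then 1 else 0)
    (hbad : ∀ (j i : ℕ) (s : LoopSeq d), s ≠ [] → ¬ (∀ l ∈ s, l ≠ []) → b j i s = 0)
    (hrec0 : ∀ (k : ℕ) (s : LoopSeq d), s ≠ [] → (∀ l ∈ s, l ≠ []) →
      (s.len : ℝ) * b (k + 2) 0 s -
          ((∑ o : InvIdx s, b (k + 2) 0 (s.negSplitAt o)) - (∑ o : SameIdx s, b (k + 2) 0 (s.posSplitAt o))) =
        (s.len : ℝ) * b (k + 1) 0 s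
          + ((∑ o : SameIdx s, b (k + 1) 0 (s.negTwistAt o)) - ∑ o : InvIdx s, b (k + 1) 0 (s.posTwistAt o))
          + ((∑ o : MergeIdx s, b k 0 (s.negMergeAt o)) - ∑ o : MergeIdx s, b k 0 (s.posMergeAt o)))
    (hrecS : ∀ (k i : ℕ) (s : LoopSeq d), s ≠ [] → (∀ l ∈ s, l ≠ []) →
      (s.len : ℝ) * b (k + 2) (i + 1) s -
          ((∑ o : InvIdx s, b (k + 2) (i + 1) (s.negSplitAt o)) - (∑ o : SameIdx s, b (k + 2) (i + 1) (s.posSplitAt o))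
            + (∑ o : DeformIdx s, b (k + 2) i (s.negDeformAt o)) - (∑ o : DeformIdx s, b (k + 2) i (s.posDeformAt o))) =
        (s.len : ℝ) * b (k + 1) (i + 1) s
          + ((∑ o : SameIdx s, b (k + 1) (i + 1) (s.negTwistAt o)) - ∑ o : InvIdx s, b (k + 1) (i + 1) (s.posTwistAt o))
          + ((∑ o : MergeIdx s, b k (i + 1) (s.negMergeAt o)) - ∑ o : MergeIdx s, b k (i + 1) (s.posMergeAt o))) :
    ∀ s : LoopSeq d, IsLoopSeq s → ∀ i : ℕ, b 2 i s = coeffA s i := by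
  intro s hs
  obtain ⟨ρ, hρ, -, F, b', -, hB, h0', h1', hnil', hbad', hrec0', hrecS', hmain, -⟩ := oneOverN_powerSeries d hd
  have hbb : b = b' := seriesCoeff_unique h0 h1 hnil hbad hrec0 hrecS h0' h1' hnil' hbad' hrec0' hrecS'
  subst hbb
  -- a common radius
  obtain ⟨β₁, hβ₁, hA⟩ := coeffA_mul_pow_summable_abs (d := d)
  have hKd : 0 < bigK d := lt_of_lt_of_le one_pos (one_le_bigK d)
  set r : ℝ := min (ρ 0) (min β₁ (1 / (2 * bigK d ^ 5))) with hr
  have hr0 : 0 < r := lt_min (hρ 0) (lt_min hβ₁ (by positivity))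
  have hrρ : r ≤ ρ 0 := min_le_left _ _
  have hr1 : r ≤ β₁ := (min_le_right _ _).trans (min_le_left _ _)
  have hrT : r ≤ 1 / (2 * bigK d ^ 5) := (min_le_right _ _).trans (min_le_right _ _)
  -- the difference of the two coefficient sequences has a vanishing power series on `(0, r]`
  have hzero := CoeffRecursionProof.eq_zero_of_tsum_eq_zero (c := fun i => b 2 i s - coeffA s i) hr0 ?_ ?_
  · intro i
    exact sub_eq_zero.mp (hzero i)
  · -- absolute convergence at radius `r`
    have hb := (hmain 0 r (by rw [abs_of_pos hr0]; exact hrρ) s hs).1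
    have ha := hA r (by rw [abs_of_pos hr0]; exact hr1) s hs
    rw [abs_of_pos hr0] at hb
    refine Summable.of_nonneg_of_le (fun i => mul_nonneg (abs_nonneg _) (pow_nonneg hr0.le _)) (fun i => ?_)
      (hb.add ha)
    calc |b 2 i s - coeffA s i| * r ^ i ≤ (|b 2 i s| + |coeffA s i|) * r ^ i :=
          mul_le_mul_of_nonneg_right (abs_sub _ _) (pow_nonneg hr0.le _)
      _ = |b 2 i s| * r ^ i + |coeffA s i * r ^ i| := by rw [abs_mul, abs_pow, abs_of_pos hr0]; ring
  · intro β hβ0 hβr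
    have hβa : |β| ≤ r := by rw [abs_of_pos hβ0]; exact hβr
    have hb := (hmain 0 β (hβa.trans hrρ) s hs).2
    have hT : Summable (fun X : Trajectory s => X.weight β) := (trajectorySum_summable_and_abs_le (hβa.trans hrT) hs).1
    have ha := hasSum_coeffA_mul_pow hT
    have hsum : HasSum (fun i => (b 2 i s - coeffA s i) * β ^ i) (F 2 β s - ∑' X : Trajectory s, X.weight β) := by
      have h := hb.sub ha
      simpa only [sub_mul] using h
    rw [hsum.tsum_eq, hB β (hβa.trans hrρ) s hs, sub_self]

end StringDuality

end Summit.QuantumFields.GaugeBoot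

end
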